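import Mathlib

/-!
# Borel normal form, auxiliary: linear vector fields on a polynomial ring

Support file for `stub_borelNormalForm` (line `symbolic-square-border-apolarity` of
`FidelityWitnesses.FidelityGapThreeSeventeen`).  The infinitesimal Borel operators of the line
(`opU`, `opV`, `opW` of the line's vocabulary) are LINEAR VECTOR FIELDS `∑ᵢ cᵢ X_{bᵢ} ∂_{aᵢ}` on
`K[x_σ]`.  This file provides, for such fields in general: the Leibniz rule, the action on monomials
(`x^d ↦ d_a x^{d - e_a + e_b}`) and on variables, the extension principle (derivations agreeing on the
variables agree: Mathlib's `MvPolynomial.derivation_ext`), weight bookkeeping along the moves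
`d ↦ d - e_a + e_b` (weight-zero fields preserve weighted homogeneous pieces; constant-shift fields shift a
second weight), and NILPOTENCY on each degree piece when a potential rises along every move.
General, PROVED; no dependency on the line's vocabulary.
-/

noncomputable section

namespace Summit.MatrixMultiplication.MatrixMultiplication.Theorems.SymbolicSquare

-- single-conjunct summit: the `Summit.<S>.<P>` prefix repeats `MatrixMultiplication` by design (D-0017)
set_option linter.dupNamespace false

open scoped BigOperators Polynomial
open Polynomial

/-! ## Linear vector fields `∑ᵢ cᵢ X_{bᵢ} ∂_{aᵢ}` on a polynomial ring: derivation property, action on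
monomials, weight bookkeeping, nilpotency, and the extension principle for derivations -/

namespace BorelLimit

universe u v

variable {K : Type u} [Field K] {σ : Type v}

section VF

/-- The commutator of two derivations (given by their Leibniz rules) satisfies the Leibniz rule. -/
theorem leibniz_bracket {L₁ L₂ : MvPolynomial σ K →ₗ[K] MvPolynomial σ K}
    (h₁ : ∀ f g : MvPolynomial σ K, L₁ (f * g) = L₁ f * g + f * L₁ g)
    (h₂ : ∀ f g : MvPolynomial σ K, L₂ (f * g) = L₂ f * g + f * L₂ g) (f g : MvPolynomial σ K) :
    (L₁ ∘ₗ L₂ - L₂ ∘ₗ L₁) (f * g) = (L₁ ∘ₗ L₂ - L₂ ∘ₗ L₁) f * g + f * (L₁ ∘ₗ L₂ - L₂ ∘ₗ L₁) g := by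
  simp only [LinearMap.sub_apply, LinearMap.comp_apply, h₁, h₂, map_add]
  ring

/-- The Mathlib derivation attached to a linear map satisfying the Leibniz rule. -/
def toDerivation (L : MvPolynomial σ K →ₗ[K] MvPolynomial σ K)
    (h : ∀ f g : MvPolynomial σ K, L (f * g) = L f * g + f * L g) :
    Derivation K (MvPolynomial σ K) (MvPolynomial σ K) :=
  Derivation.mk' L fun f g => by rw [h f g, smul_eq_mul, smul_eq_mul]; ring

/-- **Extension principle**: two derivations of `K[x_σ]` agreeing on the variables are equal. -/
theorem ext_of_leibniz {L₁ L₂ : MvPolynomial σ K →ₗ[K] MvPolynomial σ K}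
    (h₁ : ∀ f g : MvPolynomial σ K, L₁ (f * g) = L₁ f * g + f * L₁ g)
    (h₂ : ∀ f g : MvPolynomial σ K, L₂ (f * g) = L₂ f * g + f * L₂ g)
    (h : ∀ u : σ, L₁ (MvPolynomial.X u) = L₂ (MvPolynomial.X u)) : L₁ = L₂ := by
  have hD : toDerivation L₁ h₁ = toDerivation L₂ h₂ := MvPolynomial.derivation_ext fun u => h u
  apply LinearMap.ext
  intro f
  exact congrArg (fun D : Derivation K (MvPolynomial σ K) (MvPolynomial σ K) => D f) hD

/-- The elementary linear vector field `X_b ∂_a`. -/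
def xd (b a : σ) : MvPolynomial σ K →ₗ[K] MvPolynomial σ K :=
  LinearMap.mulLeft K (MvPolynomial.X b) ∘ₗ
    (MvPolynomial.pderiv a : Derivation K (MvPolynomial σ K) (MvPolynomial σ K)).toLinearMap

/-- Unfolding lemma for `xd`. -/
theorem xd_apply (b a : σ) (f : MvPolynomial σ K) :
    xd (K := K) b a f = MvPolynomial.X b * MvPolynomial.pderiv a f := rfl

/-- `X_b ∂_a` is a derivation. -/
theorem xd_leibniz (b a : σ) (f g : MvPolynomial σ K) :
    xd (K := K) b a (f * g) = xd b a f * g + f * xd b a g := by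
  rw [xd_apply, xd_apply, xd_apply, Derivation.leibniz, smul_eq_mul, smul_eq_mul]
  ring

/-- `X_b ∂_a` on a monomial: `x^d ↦ d_a · x^{d - e_a + e_b}`. -/
theorem xd_monomial (b a : σ) (d : σ →₀ ℕ) (c : K) :
    xd b a (MvPolynomial.monomial d c) =
      MvPolynomial.monomial (d - Finsupp.single a 1 + Finsupp.single b 1) (c * (d a : K)) := by
  rw [xd_apply, MvPolynomial.pderiv_monomial, MvPolynomial.X, MvPolynomial.monomial_mul, one_mul, add_comm]

/-- `X_b ∂_a` on a variable. -/
theorem xd_X [DecidableEq σ] (b a u : σ) :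
    xd (K := K) b a (MvPolynomial.X u) = if u = a then MvPolynomial.X b else 0 := by
  rw [xd_apply, MvPolynomial.pderiv_X, Pi.single_apply]
  split_ifs <;> simp

/-- `X_a ∂_a` acts diagonally on monomials: `x^d ↦ d_a x^d`. -/
theorem xd_self_monomial (a : σ) (d : σ →₀ ℕ) (c : K) :
    xd a a (MvPolynomial.monomial d c) = (d a : K) • MvPolynomial.monomial d c := by
  rw [xd_monomial]
  by_cases h : d a = 0
  · simp [h]
  · rw [tsub_add_cancel_of_le (Finsupp.single_le_iff.2 (Nat.one_le_iff_ne_zero.2 h)), MvPolynomial.smul_monomial,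
      smul_eq_mul, mul_comm]

/-- **Weight bookkeeping** for `d ↦ d - e_a + e_b`: for an additive weight `φ` and `d_a ≠ 0`,
`φ(d - e_a + e_b) + φ(e_a) = φ(d) + φ(e_b)`. -/
theorem weight_move {M : Type*} [AddCommMonoid M] (φ : (σ →₀ ℕ) →+ M) {d : σ →₀ ℕ} {a : σ} (b : σ)
    (h : d a ≠ 0) :
    φ (d - Finsupp.single a 1 + Finsupp.single b 1) + φ (Finsupp.single a 1) = φ d + φ (Finsupp.single b 1) := by
  rw [← map_add, ← map_add, add_right_comm,
    tsub_add_cancel_of_le (Finsupp.single_le_iff.2 (Nat.one_le_iff_ne_zero.2 h))]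

variable {ι : Type*} [Fintype ι] (c : ι → K) (b a : ι → σ)

/-- The LINEAR VECTOR FIELD `∑ᵢ cᵢ X_{bᵢ} ∂_{aᵢ}`. -/
def lvf : MvPolynomial σ K →ₗ[K] MvPolynomial σ K := ∑ i, c i • xd (b i) (a i)

/-- Unfolding lemma for `lvf`. -/
theorem lvf_apply (f : MvPolynomial σ K) : lvf c b a f = ∑ i, c i • xd (b i) (a i) f := by
  simp [lvf, LinearMap.sum_apply]

/-- A linear vector field is a derivation. -/
theorem lvf_leibniz (f g : MvPolynomial σ K) : lvf c b a (f * g) = lvf c b a f * g + f * lvf c b a g := by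
  rw [lvf_apply, lvf_apply, lvf_apply, Finset.sum_mul, Finset.mul_sum, ← Finset.sum_add_distrib]
  refine Finset.sum_congr rfl fun i _ => ?_
  rw [xd_leibniz, smul_add, smul_mul_assoc, mul_smul_comm]

/-- A linear vector field on a variable. -/
theorem lvf_X [DecidableEq σ] (u : σ) :
    lvf c b a (MvPolynomial.X u) = ∑ i, if u = a i then c i • MvPolynomial.X (b i) else 0 := by
  rw [lvf_apply]
  refine Finset.sum_congr rfl fun i _ => ?_
  rw [xd_X]
  split_ifs <;> simp

/-- **Support transport**: if every move `d ↦ d - e_{aᵢ} + e_{bᵢ}` (`d_{aᵢ} ≠ 0`) sends `s` into `s'`, then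
the field maps polynomials supported in `s` to polynomials supported in `s'`. -/
theorem lvf_mem_restrictSupport {s s' : Set (σ →₀ ℕ)}
    (h : ∀ d ∈ s, ∀ i, d (a i) ≠ 0 → d - Finsupp.single (a i) 1 + Finsupp.single (b i) 1 ∈ s')
    {f : MvPolynomial σ K} (hf : f ∈ MvPolynomial.restrictSupport K s) :
    lvf c b a f ∈ MvPolynomial.restrictSupport K s' := by
  classical
  rw [MvPolynomial.mem_restrictSupport_iff] at hf
  rw [← f.support_sum_monomial_coeff, map_sum]
  refine Submodule.sum_mem _ fun d hd => ?_
  rw [lvf_apply]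
  refine Submodule.sum_mem _ fun i _ => Submodule.smul_mem _ _ ?_
  rw [xd_monomial, MvPolynomial.monomial_mem_restrictSupport]
  by_cases hda : d (a i) = 0
  · right; simp [hda]
  · left; exact h d (hf hd) i hda

/-- Weight-zero fields preserve the weighted homogeneous pieces: if `wt (aᵢ) = wt (bᵢ)` for all `i`
then `lvf` maps `weightedHomogeneousSubmodule K wt m` into itself. -/
theorem lvf_mem_weightedHomogeneousSubmodule {M : Type*} [AddCancelCommMonoid M] (wt : σ → M)
    (hw : ∀ i, wt (a i) = wt (b i)) (m : M) {f : MvPolynomial σ K}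
    (hf : f ∈ MvPolynomial.weightedHomogeneousSubmodule K wt m) :
    lvf c b a f ∈ MvPolynomial.weightedHomogeneousSubmodule K wt m := by
  rw [MvPolynomial.weightedHomogeneousSubmodule_eq_finsupp_supported] at hf ⊢
  refine lvf_mem_restrictSupport c b a (fun d hd i hi => ?_) hf
  simp only [Set.mem_setOf_eq] at hd ⊢
  have := weight_move (Finsupp.weight wt) (b i) hi
  rw [Finsupp.weight_single, Finsupp.weight_single, one_smul, one_smul, hw i, hd] at this
  exact add_right_cancel this

/-- **Shifts**: if `w (bᵢ) + s₁ = w (aᵢ) + s₂` for all `i`, the field moves `w`-weight `j` to weight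
`j'` with `j' + s₁ = j + s₂`, and preserves the degree. -/
theorem lvf_monomial_mem_shift (w : σ → ℕ) (s₁ s₂ : ℕ) (hw : ∀ i, w (b i) + s₁ = w (a i) + s₂)
    (d : σ →₀ ℕ) (r : K) :
    lvf c b a (MvPolynomial.monomial d r) ∈ MvPolynomial.restrictSupport K
      {d' | Finsupp.weight w d' + s₁ = Finsupp.weight w d + s₂ ∧ Finsupp.degree d' = Finsupp.degree d} := by
  refine lvf_mem_restrictSupport c b a (s := {d}) (fun d₀ hd₀ i hi => ?_)
    ((MvPolynomial.monomial_mem_restrictSupport K).2 (Or.inl rfl))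
  rcases hd₀ with rfl
  simp only [Set.mem_setOf_eq]
  constructor
  · have h1 := weight_move (Finsupp.weight w) (b i) hi
    rw [Finsupp.weight_single, Finsupp.weight_single, one_smul, one_smul] at h1
    have h2 := hw i
    omega
  · have h1 := weight_move (Finsupp.degree) (b i) hi
    rw [Finsupp.degree_single, Finsupp.degree_single] at h1
    omega

/-- The `pot`-weight is at most `pmax · degree` when `pot ≤ pmax`. -/
theorem weight_le_mul_degree (pot : σ → ℕ) (pmax : ℕ) (hp : ∀ v, pot v ≤ pmax) (d : σ →₀ ℕ) :
    Finsupp.weight pot d ≤ pmax * Finsupp.degree d := by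
  rw [Finsupp.weight_apply, Finsupp.degree_eq_weight_one, Finsupp.weight_apply, Finsupp.sum, Finsupp.sum,
    Finset.mul_sum]
  refine Finset.sum_le_sum fun v _ => ?_
  simp only [smul_eq_mul, mul_one]
  rw [mul_comm]
  exact Nat.mul_le_mul_right _ (hp v)

/-- **Nilpotency**: if a potential rises by one along every move (`pot bᵢ = pot aᵢ + 1`), then the `k`-th
power of the field sends `x^d` into `pot`-weight `pot·d + k`, same degree. -/
theorem lvf_pow_monomial_mem (pot : σ → ℕ) (hpot : ∀ i, pot (b i) = pot (a i) + 1) (k : ℕ) (d : σ →₀ ℕ)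
    (r : K) : (lvf c b a ^ k) (MvPolynomial.monomial d r) ∈ MvPolynomial.restrictSupport K
      {d' | Finsupp.weight pot d' = Finsupp.weight pot d + k ∧ Finsupp.degree d' = Finsupp.degree d} := by
  induction k with
  | zero => simp
  | succ k ih =>
      rw [pow_succ', Module.End.mul_apply]
      refine lvf_mem_restrictSupport c b a (fun d₀ hd₀ i hi => ?_) ih
      simp only [Set.mem_setOf_eq] at hd₀ ⊢
      constructor
      · have h1 := weight_move (Finsupp.weight pot) (b i) hi
        rw [Finsupp.weight_single, Finsupp.weight_single, one_smul, one_smul, hpot i] at h1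
        omega
      · have h1 := weight_move (Finsupp.degree) (b i) hi
        rw [Finsupp.degree_single, Finsupp.degree_single] at h1
        omega

/-- **Nilpotency on a degree piece**: with a potential `pot ≤ pmax` rising along every move,
`(lvf)^k = 0` for `k > pmax·δ` on the polynomials all of whose monomials have degree `δ`. -/
theorem lvf_pow_eq_zero_of_degree (pot : σ → ℕ) (pmax : ℕ) (hp : ∀ v, pot v ≤ pmax)
    (hpot : ∀ i, pot (b i) = pot (a i) + 1) (δ : ℕ) {f : MvPolynomial σ K}
    (hf : f ∈ MvPolynomial.restrictSupport K {d | Finsupp.degree d = δ}) {k : ℕ} (hk : pmax * δ + 1 ≤ k) :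
    (lvf c b a ^ k) f = 0 := by
  classical
  rw [MvPolynomial.mem_restrictSupport_iff] at hf
  rw [← f.support_sum_monomial_coeff, map_sum]
  refine Finset.sum_eq_zero fun d hd => ?_
  have hdδ : Finsupp.degree d = δ := hf hd
  have hmem := lvf_pow_monomial_mem c b a pot hpot k d (MvPolynomial.coeff d f)
  rw [MvPolynomial.mem_restrictSupport_iff] at hmem
  by_contra hne
  obtain ⟨d', hd'⟩ := MvPolynomial.ne_zero_iff.1 hne
  have h1 := hmem (MvPolynomial.mem_support_iff.2 hd')
  simp only [Set.mem_setOf_eq] at h1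
  have h2 := weight_le_mul_degree pot pmax hp d'
  rw [h1.1, h1.2, hdδ] at h2
  omega

end VF

end BorelLimit


/-- **Auxiliary part of `stub_borelNormalForm` (registered helper stub): nilpotency of a linear vector
field with a rising potential on each degree piece** (`(∑ cᵢ X_{bᵢ} ∂_{aᵢ})^k = 0` on degree `δ` for
`k > pmax · δ`). -/
theorem stub_borelNormalForm_vf : ∀ {K : Type} [Field K] {σ : Type} {ι : Type} [Fintype ι]
    (c : ι → K) (b a : ι → σ) (pot : σ → ℕ) (pmax : ℕ), (∀ v, pot v ≤ pmax) →
    (∀ i, pot (b i) = pot (a i) + 1) → ∀ (δ : ℕ) (f : MvPolynomial σ K),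
    f ∈ MvPolynomial.restrictSupport K {d | Finsupp.degree d = δ} →
    ∀ k : ℕ, pmax * δ + 1 ≤ k → (BorelLimit.lvf c b a ^ k) f = 0 :=
  fun c b a pot pmax hp hpot δ _ hf _ hk => BorelLimit.lvf_pow_eq_zero_of_degree c b a pot pmax hp hpot δ hf hk

end Summit.MatrixMultiplication.MatrixMultiplication.Theorems.SymbolicSquare

end
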